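import Summits.HodgeConjecture.HodgeConjecture.Theorems.K2E3BranchBSkewLineIntegrals               -- ★ (K2E3-p03) brings ★ `HeisenbergStrataMeasure` ball topology (`isClosed_setOf_valued_apply_le_one`, `isOpen_setOf_valued_apply_lt_one`), the `HeisRing` chart
import Summits.HodgeConjecture.HodgeConjecture.Theorems.F0P3cStCharTSTorusRay                      -- ★ `exists_uniformizer_units` (a uniformiser unit `ϖ ∈ Rˣ`)
import HarnessLib

/-!
# R90 · S1 ∕ U4Keys leaf (U4f-χ₁-ram-one-d0B) — THE SPHERES `{r ∈ R : |r_w|_w = q_w^n}` AND THE SKEW SPHERES `{y ∈ R⁻ : |y_w|_w = q_w^n}` ARE BOREL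
# (the letter `hS1` of ★∕📤 `R90S1RamifiedShellOneFibre` ∕ `R90S1RamifiedShellOneFibreVanishing`, any finite place)
# [Rogawski1990 §1.10; WeilBNT1967 Ch. I §4]

Cell `hodgecm-mathlib`, SLAB R90-TF, section S1 «Ch. 12 local», crux H413 = `stmt-HodgeConjecture-24833` (lane `--supports … --as helper`), route HCCMUnconditional; prover seat
`hodgecm-mathlib-R90-C10-p05` (g0).  THEOREMS ONLY (no definition ∕ instance ∕ notation ∕ named fact ∕ `sorry`); ★-only imports.  FRAME (v1 spellings): `R := LocalRing L v = Π_{w′∣v} L_{w′}`,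
`σ := conjLocal L c v`, `R⁻ = skewPart σ`; ANY finite place `v` (no non-split ∕ ramified hypothesis).
THE POINT.  The tree has the unit ball and the unit sphere of `R` at `w` as closed ∕ open sets (★ `isClosed_setOf_valued_apply_le_one`, ★ `isOpen_setOf_valued_apply_lt_one`); the sphere of
radius `exp n` is the preimage of the unit sphere under the homeomorphism `r ↦ ϖⁿ·r` for a uniformiser unit `ϖ ∈ Rˣ` (★ `exists_uniformizer_units`: `|ϖ_{w′}|_{w′} = exp(−1)` at every
`w′ ∣ v`), hence Borel; the skew sphere is its trace on the closed subgroup `R⁻`.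
* `measurableSet_setOf_valued_apply_eq_exp` (`{r : |r_w| = exp n}` is Borel), **`measurableSet_skewSphere_exp`** (`{y ∈ R⁻ : |y_w| = exp n}` is Borel).
HONEST LABEL.  HC_CM is proved only modulo the 7 printed citations (2 remaining named inputs: hLiu418 = `stmt-HodgeConjecture-24832`, h413 = `stmt-HodgeConjecture-24833`) until rung 0
closes; count-neutral — this file does NOT pay the leaf; no printed citation is discharged.

## References
* [Rogawski1990] J. D. Rogawski, *Automorphic Representations of Unitary Groups in Three Variables*, Ann. of Math. Stud. 123 (1990), §1.10 p. 9.
* [WeilBNT1967] A. Weil, *Basic Number Theory* (1967), Ch. I §4 (the topology of a local field: balls and spheres are open and closed).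
-/

set_option autoImplicit false
-- the mandated namespace has the single-problem summit's repeated segment (`HodgeConjecture.HodgeConjecture`)
set_option linter.dupNamespace false

noncomputable section

open NumberField IsDedekindDomain MeasureTheory Topology Set
open Literature.NumberTheory Literature.NumberTheory.Automorphic Literature.NumberTheory.Automorphic.UnitaryGroup

namespace Summit.HodgeConjecture.HodgeConjecture.R90.S1

open Summit.HodgeConjecture.HodgeConjecture.Cruxes.H413

variable (L : Type) [Field L] [NumberField L] [IsCMField L] (v : HeightOneSpectrum (𝓞 ↥(maximalRealSubfield L))) (w : PlacesOver L v)

omit [IsCMField L] in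
/-- **The sphere `{r ∈ R : |r_w|_w = exp n}` is Borel** (`n ∈ ℤ`): it is the preimage of the unit sphere `{|r_w| ≤ 1} ∖ {|r_w| < 1}` (closed minus open, ★ `HeisenbergStrataMeasure`) under the
continuous map `r ↦ ϖⁿ·r`, `ϖ ∈ Rˣ` a uniformiser unit (★ `exists_uniformizer_units`). [cite: WeilBNT1967, Ch. I §4] [cite: Rogawski1990, §1.10 p. 9] -/
theorem measurableSet_setOf_valued_apply_eq_exp [MeasurableSpace (LocalRing L v)] [BorelSpace (LocalRing L v)] (n : ℤ) :
    MeasurableSet {r : LocalRing L v | Valued.v (r w) = WithZero.exp n} := by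
  obtain ⟨ϖ, hϖ⟩ := F0P3cStCharTSTorusRay.exists_uniformizer_units L v
  have hS1 : MeasurableSet {r : LocalRing L v | Valued.v (r w) = 1} := by
    have h1 : {r : LocalRing L v | Valued.v (r w) = 1} = {r : LocalRing L v | Valued.v (r w) ≤ 1} \ {r : LocalRing L v | Valued.v (r w) < 1} := by
      ext r; simp only [Set.mem_setOf_eq, Set.mem_sdiff, not_lt]; exact ⟨fun h => ⟨h.le, h.ge⟩, fun h => le_antisymm h.1 h.2⟩
    rw [h1]
    exact (isClosed_setOf_valued_apply_le_one L v w).measurableSet.diff (isOpen_setOf_valued_apply_lt_one L v w).measurableSet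
  have hϖn : Valued.v ((((ϖ ^ n : (LocalRing L v)ˣ)) : LocalRing L v) w) = WithZero.exp (-n) := by
    rw [F0P3cStCharTSTorusRay.valued_coe_zpow_apply L v ϖ n w, hϖ w, ← WithZero.exp_zsmul, smul_eq_mul, mul_neg, mul_one]
  have hpre : {r : LocalRing L v | Valued.v (r w) = WithZero.exp n} =
      (fun r : LocalRing L v => (((ϖ ^ n : (LocalRing L v)ˣ)) : LocalRing L v) * r) ⁻¹' {r : LocalRing L v | Valued.v (r w) = 1} := by
    ext r
    simp only [Set.mem_setOf_eq, Set.mem_preimage, Pi.mul_apply, map_mul, hϖn]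
    constructor
    · intro h; rw [h, ← WithZero.exp_add, neg_add_cancel, WithZero.exp_zero]
    · intro h
      have h' : WithZero.exp (-n) * Valued.v (r w) = WithZero.exp (-n) * WithZero.exp n := by
        rw [h, ← WithZero.exp_add, neg_add_cancel, WithZero.exp_zero]
      exact mul_left_cancel₀ WithZero.coe_ne_zero h'
  rw [hpre]
  exact hS1.preimage (continuous_const.mul continuous_id).measurable

/-- **The skew sphere `{y ∈ R⁻ : |y_w|_w = exp n}` is Borel** — the trace of the Borel sphere of `R` on the subtype `R⁻ = skewPart σ`.  With `n = 1` this is the letter `hS1` of ★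
`heisZFibreOne_eq_skewSphereIntegral_ram` ∕ `heisZFibreOne_eq_zero_ram`. [cite: WeilBNT1967, Ch. I §4] [cite: Rogawski1990, §1.10 p. 9] -/
theorem measurableSet_skewSphere_exp [MeasurableSpace (LocalRing L v)] [BorelSpace (LocalRing L v)] (n : ℤ) :
    MeasurableSet {y : ↥(HeisRing.skewPart (conjLocal L (IsCMField.complexConj L) v)) | Valued.v ((y : LocalRing L v) w) = WithZero.exp n} :=
  measurable_subtype_coe (measurableSet_setOf_valued_apply_eq_exp L v w n)

end Summit.HodgeConjecture.HodgeConjecture.R90.S1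

end
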